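import Literature.AlgebraicTopology.FundamentalGroup.PlanarLassos
import Literature.AlgebraicTopology.FundamentalGroup.IsotopyTrack
import Literature.AlgebraicTopology.FundamentalGroup.PathSegment
import Mathlib.Analysis.Normed.Module.Convex
import HarnessLib

/-!
# Loops of an open set are products of loops in the complex lines through the base point

Topic `Literature/AlgebraicTopology/FundamentalGroup`.  Let `E` be a complex normed space,
`U ⊆ E` open and `s ∈ U`.  For `z ∈ E` the **complex line through `s` and `z`**,
`c ↦ s + c (z - s)` (`linePt s z c`), meets `U` in the **slice** `Λ_z = {c | s + c (z - s) ∈ U} ⊆ ℂ`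
(`lineSlice U s z`, an open planar region containing `0`, and containing `1` iff `z ∈ U`), and
`J_z : Λ_z → U` (`lineIncl`) is the corresponding continuous map, `J_z(0) = s`.

**Theorem** (`closure_iUnion_range_lineInclHom_eq_top`).  Suppose that for every `z ∈ U` the
points `0` and `1` of the slice `Λ_z` are joined by a path in `Λ_z` (e.g. `Λ_z` is the complement
of finitely many points of `ℂ`).  Then for every DENSE set `G ⊆ E`, the fundamental group
`π₁(U, s)` is generated by the images `(J_z)_* π₁(Λ_z, 0)`, `z ∈ G`: every loop at `s` is a product
of loops each lying in a (punctured) complex line through `s` and a point of `G`.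

This is an elementary weak form — all lines through the base point, no genericity — of Zariski's
theorem on fundamental groups of hypersurface complements (Voisin II, Thm. 3.22: for ONE generic
line `Δ` through the base point, `π₁(Δ ∖ Δ ∩ H) → π₁(ℙⁿ ∖ H)` is onto; Carlson–Toledo §3 "`π₁(S − Δ)`
is generated by meridians"), sufficient for the Zariski–van Kampen GENERATION theorem
(`Literature/AlgebraicGeometry/FundamentalGroup/HypersurfaceComplementMeridiansGenerate`).

## Proof (the line-subdivision argument)

For a planar path `ω : 0 ⇝ 1` and `z ∈ E` put `Good ω z :⇔ ∀ t, s + ω(t)(z - s) ∈ U`; then the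
"radial" path `rad_ω z : t ↦ s + ω(t)(z - s)` joins `s` to `z` inside `U`.  (1) `{z | Good ω z}` is
open (compactness of `I`); (2) every `z ∈ U` is good for some `ω` (hypothesis); (3) SQUARE: if a
path `p : z₀ ⇝ z₁` of `U` stays in `{Good ω}`, then `(t, θ) ↦ s + ω(t)(p(θ) - s)` is a map of the
square into `U` with edges `s` (constant), `p`, `rad_ω z₀`, `rad_ω z₁`, so
`[p] = [rad_ω z₀]⁻¹ · [rad_ω z₁]`; (4) by the Lebesgue number lemma a loop `γ` at `s` splits as
`γ = γ₁ ⋯ γₙ` with `γₖ` inside `{Good ωₖ}`; telescoping with (3),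
`[γ] = ∏ₖ [rad_{ωₖ₋₁} zₖ] · [rad_{ωₖ} zₖ]⁻¹` (`zₖ` the break points), and each factor is a loop in
the line through `s` and `zₖ`; (5) moving `zₖ` to a nearby point `qₖ ∈ G` good for both `ωₖ₋₁`
and `ωₖ` along a straight segment does not change the factor (two applications of (3)), and
`[rad_ω q] · [rad_ω' q]⁻¹ = (J_q)_* [ω · ω'⁻¹]`.

## References

* C. Voisin, *Hodge Theory and Complex Algebraic Geometry II*, CUP (2003), §3.2.2 Thm. 3.22
  (Zariski's theorem) and Fig. 3.2. [VoisinHodgeII2003]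
* J. A. Carlson, D. Toledo, *Discriminant complements and kernels of monodromy representations*,
  Duke Math. J. 97 (1999), §3. [CarlsonToledo1999]
* A. Hatcher, *Algebraic Topology*, CUP (2002), §1.1 Lemma 1.19, §1.2 Lemma 1.15 (the Lebesgue
  number subdivision of a loop). [HatcherAT2002]

## Design notes

* `_root_.FundamentalGroup` is written in full (CONVENTIONS.md §2).
* No declaration in this file uses `sorry`.
-/

noncomputable section

open Set Function unitInterval Topology Complex Filter

namespace Literature.AlgebraicTopology.FundamentalGroup

namespace LineSlice

variable {E : Type*} [NormedAddCommGroup E] [NormedSpace ℂ E]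

/-! ### Complex lines through the base point and their slices -/

/-- The point `s + c (z - s)` of the complex line through `s` and `z` (parameter `c = 0` at `s`,
`c = 1` at `z`). [cite: VoisinHodgeII2003, §3.2.2 (lines through the base point)] -/
def linePt (s z : E) (c : ℂ) : E := s + c • (z - s)

/-- `c = 0` is the base point. [cite: VoisinHodgeII2003, §3.2.2 (lines through the base point)] -/
@[simp] theorem linePt_zero (s z : E) : linePt s z 0 = s := by simp [linePt]

/-- `c = 1` is the point `z`. [cite: VoisinHodgeII2003, §3.2.2 (lines through the base point)] -/
@[simp] theorem linePt_one (s z : E) : linePt s z 1 = z := by simp [linePt]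

/-- The line through `s` and `s` is the point `s`. [cite: VoisinHodgeII2003, §3.2.2 (lines through the base point)] -/
@[simp] theorem linePt_self (s : E) (c : ℂ) : linePt s s c = s := by simp [linePt]

/-- `linePt` is jointly continuous in the point and the parameter. [cite: VoisinHodgeII2003, §3.2.2 (lines through the base point)] -/
theorem continuous_linePt (s : E) : Continuous (fun p : E × ℂ => linePt s p.1 p.2) := by
  unfold linePt; fun_prop

/-- The **slice** of `U` by the complex line through `s` and `z`: the parameters `c` with
`s + c (z - s) ∈ U`. [cite: VoisinHodgeII2003, §3.2.2 Thm. 3.22 (the punctured line `Δ - Δ ∩ Y`)] -/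
def lineSlice (U : Set E) (s z : E) : Set ℂ := {c | linePt s z c ∈ U}

/-- Membership in the slice. [cite: VoisinHodgeII2003, §3.2.2 Thm. 3.22 (the punctured line)] -/
@[simp] theorem mem_lineSlice {U : Set E} {s z : E} {c : ℂ} : c ∈ lineSlice U s z ↔ linePt s z c ∈ U :=
  Iff.rfl

/-- `0` lies in the slice when `s ∈ U`. [cite: VoisinHodgeII2003, §3.2.2 Thm. 3.22 (the base point `0 ∈ Δ`)] -/
theorem zero_mem_lineSlice {U : Set E} {s : E} (hs : s ∈ U) (z : E) : (0 : ℂ) ∈ lineSlice U s z := by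
  simpa [lineSlice] using hs

/-- The slice of an open set is open. [cite: VoisinHodgeII2003, §3.2.2 Thm. 3.22 (the punctured line)] -/
theorem isOpen_lineSlice {U : Set E} (hU : IsOpen U) (s z : E) : IsOpen (lineSlice U s z) :=
  hU.preimage (by unfold linePt; fun_prop)

/-- The map `J_z : Λ_z → U`, `c ↦ s + c (z - s)`, from the slice into `U`.
[cite: VoisinHodgeII2003, §3.2.2 Thm. 3.22 (the inclusion `Δ - Δ ∩ Y ↪ U`)] -/
def lineIncl (U : Set E) (s z : E) : C(↥(lineSlice U s z), ↥U) :=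
  ⟨fun c => ⟨linePt s z c, c.2⟩, ((continuous_linePt s).comp
    (continuous_const.prodMk continuous_subtype_val)).subtype_mk _⟩

/-- Values of `J_z`. [cite: VoisinHodgeII2003, §3.2.2 Thm. 3.22 (the inclusion of the punctured line)] -/
@[simp] theorem coe_lineIncl_apply {U : Set E} (s z : E) (c : lineSlice U s z) :
    (lineIncl U s z c : E) = linePt s z c := rfl

/-- `J_z(0) = s`. [cite: VoisinHodgeII2003, §3.2.2 Thm. 3.22 (base points)] -/
theorem lineIncl_zero {U : Set E} {s : E} (hs : s ∈ U) (z : E) :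
    lineIncl U s z ⟨0, zero_mem_lineSlice hs z⟩ = ⟨s, hs⟩ :=
  Subtype.ext (linePt_zero s z)

/-- The homomorphism `(J_z)_* : π₁(Λ_z, 0) → π₁(U, s)`.
[cite: VoisinHodgeII2003, §3.2.2 Thm. 3.22 (the map `π₁(Δ - Δ ∩ Y, 0) → π₁(U, 0)`)] -/
def lineInclHom (U : Set E) {s : E} (hs : s ∈ U) (z : E) :
    _root_.FundamentalGroup (↥(lineSlice U s z)) ⟨0, zero_mem_lineSlice hs z⟩ →*
      _root_.FundamentalGroup (↥U) ⟨s, hs⟩ :=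
  FundamentalGroup.mapOfEq (lineIncl U s z) (lineIncl_zero hs z)


/-! ### Good planar paths and radial paths -/

variable {U : Set E} {s : E}

/-- `Good U s ω z`: the planar path `ω : 0 ⇝ 1`, read in the complex line through `s` and `z`,
stays in `U` — so that `t ↦ s + ω(t)(z - s)` is a path of `U` from `s` to `z`.
[cite: VoisinHodgeII2003, §3.2.2 Thm. 3.22 (paths in the punctured line)] -/
def Good (U : Set E) (s : E) (ω : Path (0 : ℂ) 1) (z : E) : Prop := ∀ t, linePt s z (ω t) ∈ U

/-- A good point lies in `U` (`t = 1`). [cite: VoisinHodgeII2003, §3.2.2 Thm. 3.22 (paths in the punctured line)] -/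
theorem Good.mem {ω : Path (0 : ℂ) 1} {z : E} (h : Good U s ω z) : z ∈ U := by
  simpa using h 1

/-- The base point is good for every `ω` (the line degenerates to the point `s`).
[cite: VoisinHodgeII2003, §3.2.2 Thm. 3.22 (paths in the punctured line)] -/
theorem good_self (hs : s ∈ U) (ω : Path (0 : ℂ) 1) : Good U s ω s := fun t => by simpa using hs

/-- For `z ∈ U`, if `0` and `1` are joined in the slice `Λ_z` then `z` is good for some `ω`.
[cite: VoisinHodgeII2003, §3.2.2 Thm. 3.22 (paths in the punctured line)] -/
theorem exists_good_of_joinedIn {z : E} (h : JoinedIn (lineSlice U s z) 0 1) :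
    ∃ ω : Path (0 : ℂ) 1, Good U s ω z :=
  ⟨h.somePath, fun t => h.somePath_mem t⟩

/-- **The set of points good for a fixed `ω` is open** (the image of the compact interval stays
inside the open set `U` for all nearby points). [cite: HatcherAT2002, §1.2 Lemma 1.15 (compactness argument)] -/
theorem isOpen_setOf_good (hU : IsOpen U) (s : E) (ω : Path (0 : ℂ) 1) :
    IsOpen {z | Good U s ω z} := by
  rw [isOpen_iff_mem_nhds]
  intro z hz
  have hc : Continuous (fun p : E × I => linePt s p.1 (ω p.2)) := by unfold linePt; fun_prop
  have key : ∀ᶠ x in 𝓝 z, ∀ t ∈ (univ : Set I), linePt s x (ω t) ∈ U := by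
    refine isCompact_univ.eventually_forall_of_forall_eventually fun t _ => ?_
    exact hc.continuousAt.eventually_mem (hU.mem_nhds (hz t))
  filter_upwards [key] with x hx
  exact fun t => hx t (mem_univ t)

/-- The **radial path** `rad_ω z : t ↦ s + ω(t)(z - s)` of `U` from `s` to a good point `z`.
[cite: VoisinHodgeII2003, §3.2.2 Thm. 3.22 (paths in the punctured line)] -/
def radPath (hs : s ∈ U) (ω : Path (0 : ℂ) 1) (z : E) (hz : Good U s ω z) :
    Path (⟨s, hs⟩ : U) ⟨z, hz.mem⟩ where
  toFun t := ⟨linePt s z (ω t), hz t⟩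
  continuous_toFun := ((continuous_linePt s).comp
    (continuous_const.prodMk ω.continuous)).subtype_mk _
  source' := Subtype.ext (by simp)
  target' := Subtype.ext (by simp)

/-- Values of the radial path. [cite: VoisinHodgeII2003, §3.2.2 Thm. 3.22 (paths in the punctured line)] -/
@[simp] theorem coe_radPath_apply (hs : s ∈ U) (ω : Path (0 : ℂ) 1) (z : E) (hz : Good U s ω z)
    (t : I) : (radPath hs ω z hz t : E) = linePt s z (ω t) := rfl

/-! ### The square: a path inside `{Good ω}` is `rad⁻¹ · rad` -/

/-- **Square lemma for radial paths.** If a path `p : z₀ ⇝ z₁` of `U` stays inside the set of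
points good for `ω`, then `[p] = [rad_ω z₀]⁻¹ · [rad_ω z₁]` in the fundamental groupoid of `U`:
the map `(t, θ) ↦ s + ω(t)(p(θ) - s)` of the square has edges the constant path `s`, `p`,
`rad_ω z₀` and `rad_ω z₁`. [cite: HatcherAT2002, §1.1 Lemma 1.19 (square homotopies)] -/
theorem mk_eq_radPath_symm_trans (hs : s ∈ U) (ω : Path (0 : ℂ) 1) {z₀ z₁ : U} (p : Path z₀ z₁)
    (hp : ∀ θ, Good U s ω (p θ)) (h₀ : Good U s ω z₀) (h₁ : Good U s ω z₁) :
    Path.Homotopic.Quotient.mk p =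
      (Path.Homotopic.Quotient.mk (radPath hs ω z₀ h₀)).symm.trans
        (Path.Homotopic.Quotient.mk (radPath hs ω z₁ h₁)) := by
  let F : C(I × I, U) := ⟨fun q => ⟨linePt s (p q.2) (ω q.1), hp q.2 q.1⟩,
    ((continuous_linePt s).comp ((continuous_subtype_val.comp (p.continuous.comp continuous_snd)).prodMk
      (ω.continuous.comp continuous_fst))).subtype_mk _⟩
  have hsq := Square.mk_trans_eq F (radPath hs ω z₀ h₀) (radPath hs ω z₁ h₁)
    (Path.refl (⟨s, hs⟩ : U)) p
    (fun t => Subtype.ext (by simp [F])) (fun t => Subtype.ext (by simp [F]))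
    (fun θ => Subtype.ext (by simp [F])) (fun θ => Subtype.ext (by simp [F]))
  rw [Path.Homotopic.Quotient.mk_refl, Path.Homotopic.Quotient.refl_trans] at hsq
  rw [hsq, IsotopyTrack.quotient_symm_trans_trans]

/-! ### Loops in one line -/

/-- **The loop `rad_ω₁ q · (rad_ω₂ q)⁻¹` lies in the image of `π₁` of the line through `s` and
`q`**: it is `(J_q)_*` of the class of the planar loop `ω₁ · ω₂⁻¹` of the slice `Λ_q`.
[cite: VoisinHodgeII2003, §3.2.2 Thm. 3.22 (loops in the punctured line)] -/
theorem radPath_trans_symm_mem_range (hs : s ∈ U) (ω₁ ω₂ : Path (0 : ℂ) 1) (q : E)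
    (h₁ : Good U s ω₁ q) (h₂ : Good U s ω₂ q) :
    FundamentalGroup.fromPath ((Path.Homotopic.Quotient.mk (radPath hs ω₁ q h₁)).trans
      (Path.Homotopic.Quotient.mk (radPath hs ω₂ q h₂)).symm) ∈ (lineInclHom U hs q).range := by
  -- the planar loop `ω₁ · ω₂⁻¹`, inside the slice
  have hmem : ∀ t, (ω₁.trans ω₂.symm) t ∈ lineSlice U s q := by
    intro t
    rw [Path.trans_apply]
    split_ifs
    · exact h₁ _
    · exact h₂ _
  let ℓ : Path (⟨0, zero_mem_lineSlice hs q⟩ : lineSlice U s q) ⟨0, zero_mem_lineSlice hs q⟩ :=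
    { toFun := fun t => ⟨(ω₁.trans ω₂.symm) t, hmem t⟩
      continuous_toFun := (ω₁.trans ω₂.symm).continuous.subtype_mk _
      source' := Subtype.ext (by simp)
      target' := Subtype.ext (by simp) }
  refine ⟨FundamentalGroup.fromPath (Path.Homotopic.Quotient.mk ℓ), ?_⟩
  rw [lineInclHom, FundamentalGroup.mapOfEq_apply, ← Path.Homotopic.Quotient.mk_symm,
    ← Path.Homotopic.Quotient.mk_trans]
  change FundamentalGroup.fromPath (Path.Homotopic.Quotient.mk _) =
    FundamentalGroup.fromPath (Path.Homotopic.Quotient.mk _)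
  congr 2
  ext t
  change linePt s q ((ω₁.trans ω₂.symm) t) = (((radPath hs ω₁ q h₁).trans (radPath hs ω₂ q h₂).symm) t : E)
  rw [Path.trans_apply, Path.trans_apply]
  split_ifs <;> rfl

/-- **Moving the through-point.** If `z` is good for `ω₁` and `ω₂` and `G` is dense, there is
`q ∈ G`, good for both, with `[rad_ω₁ z] · [rad_ω₂ z]⁻¹ = [rad_ω₁ q] · [rad_ω₂ q]⁻¹`: choose `q` in a
ball about `z` inside the open set `{Good ω₁} ∩ {Good ω₂}` and apply the square lemma to the
straight segment `z ⇝ q` twice. [cite: HatcherAT2002, §1.1 Lemma 1.19 (square homotopies)] -/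
theorem exists_mem_radPath_trans_symm_eq (hU : IsOpen U) (hs : s ∈ U) {G : Set E} (hG : Dense G)
    (ω₁ ω₂ : Path (0 : ℂ) 1) {z : E} (h₁ : Good U s ω₁ z) (h₂ : Good U s ω₂ z) :
    ∃ q ∈ G, ∃ (hq₁ : Good U s ω₁ q) (hq₂ : Good U s ω₂ q),
      (Path.Homotopic.Quotient.mk (radPath hs ω₁ z h₁)).trans
          (Path.Homotopic.Quotient.mk (radPath hs ω₂ z h₂)).symm =
        (Path.Homotopic.Quotient.mk (radPath hs ω₁ q hq₁)).trans
          (Path.Homotopic.Quotient.mk (radPath hs ω₂ q hq₂)).symm := by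
  have hO : IsOpen ({w | Good U s ω₁ w} ∩ {w | Good U s ω₂ w}) :=
    (isOpen_setOf_good hU s ω₁).inter (isOpen_setOf_good hU s ω₂)
  obtain ⟨r, hr, hball⟩ := Metric.isOpen_iff.1 hO z ⟨h₁, h₂⟩
  obtain ⟨q, hqG, hqball⟩ := hG.exists_mem_open Metric.isOpen_ball ⟨z, Metric.mem_ball_self hr⟩
  have hseg : ∀ θ : I, z + ((θ : ℝ) : ℂ) • (q - z) ∈ Metric.ball z r := by
    intro θ
    rw [Metric.mem_ball, dist_eq_norm, add_sub_cancel_left, norm_smul]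
    rw [Metric.mem_ball, dist_eq_norm] at hqball
    have hθ : ‖((θ : ℝ) : ℂ)‖ ≤ 1 := by
      rw [Complex.norm_real, Real.norm_eq_abs, abs_of_nonneg θ.2.1]; exact θ.2.2
    calc ‖((θ : ℝ) : ℂ)‖ * ‖q - z‖ ≤ 1 * ‖q - z‖ :=
          mul_le_mul_of_nonneg_right hθ (norm_nonneg _)
      _ < r := by rw [one_mul]; exact hqball
  have hgood : ∀ θ : I, Good U s ω₁ (z + ((θ : ℝ) : ℂ) • (q - z)) ∧ Good U s ω₂ (z + ((θ : ℝ) : ℂ) • (q - z)) :=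
    fun θ => hball (hseg θ)
  have hq := hball hqball
  let p : Path (⟨z, h₁.mem⟩ : U) ⟨q, hq.1.mem⟩ :=
    { toFun := fun θ => ⟨z + ((θ : ℝ) : ℂ) • (q - z), (hgood θ).1.mem⟩
      continuous_toFun := by
        refine Continuous.subtype_mk ?_ _
        fun_prop
      source' := Subtype.ext (by simp)
      target' := Subtype.ext (by simp) }
  have e₁ := mk_eq_radPath_symm_trans hs ω₁ p (fun θ => (hgood θ).1) h₁ hq.1
  have e₂ := mk_eq_radPath_symm_trans hs ω₂ p (fun θ => (hgood θ).2) h₂ hq.2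
  refine ⟨q, hqG, hq.1, hq.2, ?_⟩
  -- `R₁q = R₁z · [p]`, `R₂q⁻¹ = [p]⁻¹ · R₂z⁻¹`
  have f₁ : Path.Homotopic.Quotient.mk (radPath hs ω₁ q hq.1) =
      (Path.Homotopic.Quotient.mk (radPath hs ω₁ z h₁)).trans (Path.Homotopic.Quotient.mk p) := by
    rw [e₁, IsotopyTrack.quotient_trans_symm_trans]
  have f₂ : (Path.Homotopic.Quotient.mk (radPath hs ω₂ q hq.2)).symm =
      (Path.Homotopic.Quotient.mk p).symm.trans (Path.Homotopic.Quotient.mk (radPath hs ω₂ z h₂)).symm := by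
    rw [← IsotopyTrack.quotient_symm_trans, e₂, IsotopyTrack.quotient_trans_symm_trans]
  rw [f₁, f₂, Path.Homotopic.Quotient.trans_assoc, ← Path.Homotopic.Quotient.trans_assoc
    (Path.Homotopic.Quotient.mk p), Path.Homotopic.Quotient.trans_symm,
    Path.Homotopic.Quotient.refl_trans]


/-! ### Subdivision of a loop -/

/-- `fromPath (A · B) = fromPath B * fromPath A` (Mathlib's multiplication of `π₁` is composition
in the fundamental groupoid, read right to left). [cite: HatcherAT2002, §1.1 (product in `π₁`)] -/
theorem fromPath_trans {X : Type*} [TopologicalSpace X] {x : X} (A B : Path.Homotopic.Quotient x x) :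
    FundamentalGroup.fromPath (A.trans B) = FundamentalGroup.fromPath B * FundamentalGroup.fromPath A := by
  rw [FundamentalGroup.mul_def]

/-- The point `k / N` of the unit interval (`k ≤ N`, `0 < N`). [cite: HatcherAT2002, §1.2 Lemma 1.15 (subdivision of `I`)] -/
def pt (N k : ℕ) (hk : k ≤ N) : I :=
  ⟨(k : ℝ) / N, div_nonneg (Nat.cast_nonneg k) (Nat.cast_nonneg N),
    div_le_one_of_le₀ (by exact_mod_cast hk) (Nat.cast_nonneg N)⟩

/-- Value of `pt`. [cite: HatcherAT2002, §1.2 Lemma 1.15 (subdivision of `I`)] -/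
@[simp] theorem coe_pt (N k : ℕ) (hk : k ≤ N) : (pt N k hk : ℝ) = (k : ℝ) / N := rfl

/-- The **prefix** `u ↦ γ(u τ)` of a loop `γ`, a path from the base point to `γ τ`.
[cite: HatcherAT2002, §1.2 Lemma 1.15 (subdivision of a loop)] -/
def prefixPath {X : Type*} [TopologicalSpace X] {x : X} (γ : Path x x) (τ : I) : Path x (γ τ) where
  toFun u := γ.extend ((u : ℝ) * τ)
  continuous_toFun := γ.continuous_extend.comp (by fun_prop)
  source' := by simp
  target' := by simp

/-- Values of the prefix. [cite: HatcherAT2002, §1.2 Lemma 1.15 (subdivision of a loop)] -/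
@[simp] theorem prefixPath_apply {X : Type*} [TopologicalSpace X] {x : X} (γ : Path x x) (τ u : I) :
    prefixPath γ τ u = γ.extend ((u : ℝ) * τ) := rfl

/-- Membership of `(k + u)/N` in the unit interval for `k < N`, `u ∈ I`.
[cite: HatcherAT2002, §1.2 Lemma 1.15 (subdivision of `I`)] -/
theorem div_mem_I {N k : ℕ} (hk : k < N) (u : I) : ((k : ℝ) + u) / N ∈ I := by
  have hN : (0 : ℝ) < N := by exact_mod_cast (Nat.zero_le k).trans_lt hk
  refine ⟨div_nonneg (add_nonneg (Nat.cast_nonneg k) u.2.1) hN.le, ?_⟩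
  rw [div_le_one hN]
  have : (k : ℝ) + 1 ≤ N := by exact_mod_cast hk
  linarith [u.2.2]

/-- The **piece** `u ↦ γ((k + u)/N)` of a loop `γ` between the break points `k/N` and `(k+1)/N`.
[cite: HatcherAT2002, §1.2 Lemma 1.15 (subdivision of a loop)] -/
def piecePath {X : Type*} [TopologicalSpace X] {x : X} (γ : Path x x) {N k : ℕ}
    (hk : k < N) : Path (γ (pt N k hk.le)) (γ (pt N (k + 1) hk)) where
  toFun u := γ.extend (((k : ℝ) + u) / N)
  continuous_toFun := γ.continuous_extend.comp (by fun_prop)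
  source' := by
    rw [← Path.extend_extends']
    simp
  target' := by
    rw [← Path.extend_extends']
    simp

/-- Values of the piece. [cite: HatcherAT2002, §1.2 Lemma 1.15 (subdivision of a loop)] -/
@[simp] theorem piecePath_apply {X : Type*} [TopologicalSpace X] {x : X} (γ : Path x x) {N k : ℕ}
    (hk : k < N) (u : I) : piecePath γ hk u = γ.extend (((k : ℝ) + u) / N) := rfl

/-- **Splitting off a piece**: `γ[0, (k+1)/N] ≃ γ[0, k/N] · γ[k/N, (k+1)/N]` (reparametrisation,
`PathSegment.homotopic_of_extend`). [cite: HatcherAT2002, §1.2 Lemma 1.15 (subdivision of a loop)] -/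
theorem mk_prefixPath_succ {X : Type*} [TopologicalSpace X] {x : X} (γ : Path x x) {N k : ℕ}
    (hk : k < N) :
    Path.Homotopic.Quotient.mk (prefixPath γ (pt N (k + 1) hk)) =
      (Path.Homotopic.Quotient.mk (prefixPath γ (pt N k hk.le))).trans
        (Path.Homotopic.Quotient.mk (piecePath γ hk)) := by
  rw [← Path.Homotopic.Quotient.mk_trans]
  refine Path.Homotopic.Quotient.eq.2 (PathSegment.homotopic_of_extend γ _ _
    (fun u => (u : ℝ) * (((k : ℝ) + 1) / N))
    (fun u => if (u : ℝ) ≤ 1 / 2 then (2 * (u : ℝ)) * ((k : ℝ) / N) else ((k : ℝ) + (2 * (u : ℝ) - 1)) / N)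
    (by fun_prop) ?_ (fun u => by simp) (fun u => ?_) (by norm_num) ?_)
  · refine Continuous.if_le ?_ ?_ (by fun_prop) continuous_const fun u hu => ?_
    · fun_prop
    · fun_prop
    · rw [hu]; ring
  · rw [Path.trans_apply]
    split_ifs with h
    · rw [prefixPath_apply, coe_pt]
    · rw [piecePath_apply]
  · norm_num

/-! ### The theorem -/

/-- **Loops of `U` are products of loops in the complex lines through the base point.**  Let `E`
be a complex normed space, `U ⊆ E` open, `s ∈ U`, and suppose that for every `z ∈ U` the points
`0`, `1` of the slice `Λ_z = {c | s + c(z - s) ∈ U}` are joined by a path in `Λ_z`.  Then for every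
dense `G ⊆ E`, `π₁(U, s)` is generated by the images `(J_z)_* π₁(Λ_z, 0)` of the fundamental
groups of the slices, `z ∈ G` (an elementary weak form, for all lines through the base point, of
Zariski's theorem, Voisin II Thm. 3.22; proof: the line-subdivision argument of the module
docstring). [cite: VoisinHodgeII2003, §3.2.2 Thm. 3.22 (Zariski's theorem; weak form for all lines through the base point)]
[cite: CarlsonToledo1999, §3 (`π₁(S − Δ)` is generated by meridians)] -/
theorem closure_iUnion_range_lineInclHom_eq_top (hU : IsOpen U) (hs : s ∈ U)
    (hslice : ∀ z ∈ U, JoinedIn (lineSlice U s z) 0 1) {G : Set E} (hG : Dense G) :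
    Subgroup.closure (⋃ z ∈ G, ((lineInclHom U hs z).range : Set (_root_.FundamentalGroup (↥U) ⟨s, hs⟩))) = ⊤ := by
  set H := Subgroup.closure
    (⋃ z ∈ G, ((lineInclHom U hs z).range : Set (_root_.FundamentalGroup (↥U) ⟨s, hs⟩))) with hH
  have hHmem : ∀ q ∈ G, ∀ (ω₁ ω₂ : Path (0 : ℂ) 1) (h₁ : Good U s ω₁ q) (h₂ : Good U s ω₂ q),
      FundamentalGroup.fromPath ((Path.Homotopic.Quotient.mk (radPath hs ω₁ q h₁)).trans
        (Path.Homotopic.Quotient.mk (radPath hs ω₂ q h₂)).symm) ∈ H := by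
    intro q hq ω₁ ω₂ h₁ h₂
    exact Subgroup.subset_closure (Set.mem_biUnion hq (radPath_trans_symm_mem_range hs ω₁ ω₂ q h₁ h₂))
  rw [eq_top_iff]
  rintro g -
  induction g using Quotient.ind with | _ γ => ?_
  change FundamentalGroup.fromPath (Path.Homotopic.Quotient.mk γ) ∈ H
  -- every point of the loop is good for some planar path
  let cov : Path (0 : ℂ) 1 → Set I := fun ω => {θ | Good U s ω ((γ θ : U) : E)}
  have hcov_open : ∀ ω, IsOpen (cov ω) := fun ω =>
    (isOpen_setOf_good hU s ω).preimage (continuous_subtype_val.comp γ.continuous)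
  have hcov : (univ : Set I) ⊆ ⋃ ω, cov ω := by
    intro θ _
    obtain ⟨ω, hω⟩ := exists_good_of_joinedIn (hslice _ (γ θ).2)
    exact Set.mem_iUnion.2 ⟨ω, hω⟩
  obtain ⟨δ, hδ, hleb⟩ := lebesgue_number_lemma_of_metric isCompact_univ hcov_open hcov
  obtain ⟨n, hn⟩ := exists_nat_one_div_lt hδ
  set N : ℕ := n + 1 with hN_def
  have hN : 0 < N := Nat.succ_pos n
  have hNδ : (1 : ℝ) / N < δ := by rw [hN_def]; exact_mod_cast hn
  have hNR : (0 : ℝ) < N := by exact_mod_cast hN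
  -- a planar path for each piece
  have hpiece : ∀ k (hk : k < N), ∃ ω : Path (0 : ℂ) 1, ∀ u : I, Good U s ω ((piecePath γ hk u : U) : E) := by
    intro k hk
    obtain ⟨ω, hω⟩ := hleb (pt N k hk.le) (mem_univ _)
    refine ⟨ω, fun u => ?_⟩
    have hmem : (⟨((k : ℝ) + u) / N, div_mem_I hk u⟩ : I) ∈ cov ω := by
      apply hω
      rw [Metric.mem_ball, Subtype.dist_eq, coe_pt, Real.dist_eq]
      have : ((k : ℝ) + u) / N - k / N = (u : ℝ) / N := by ring
      rw [this, abs_of_nonneg (div_nonneg u.2.1 hNR.le)]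
      calc (u : ℝ) / N ≤ 1 / N := div_le_div_of_nonneg_right u.2.2 hNR.le
        _ < δ := hNδ
    have e : (piecePath γ hk u : U) = γ ⟨((k : ℝ) + u) / N, div_mem_I hk u⟩ := by
      rw [piecePath_apply, ← Path.extend_extends']
    rw [e]
    exact hmem
  -- the telescoping induction over the break points
  have claim : ∀ k (hk : k ≤ N) (ω : Path (0 : ℂ) 1) (hω : Good U s ω ((γ (pt N k hk) : U) : E)),
      FundamentalGroup.fromPath ((Path.Homotopic.Quotient.mk (prefixPath γ (pt N k hk))).trans
        (Path.Homotopic.Quotient.mk (radPath hs ω _ hω)).symm) ∈ H := by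
    intro k
    induction k with
    | zero =>
      intro hk ω hω
      have hγ0 : ((γ (pt N 0 hk) : U) : E) = s := by
        have : pt N 0 hk = 0 := Subtype.ext (by simp)
        rw [this, γ.source]
      have hconst : (prefixPath γ (pt N 0 hk)).trans (radPath hs ω _ hω).symm =
          Path.refl (⟨s, hs⟩ : U) := by
        ext u
        rw [Path.trans_apply]
        split_ifs with h
        · rw [prefixPath_apply, coe_pt, Nat.cast_zero, zero_div, mul_zero, Path.extend_zero]
          rfl
        · change (linePt s ((γ (pt N 0 hk) : U) : E) _) = s
          rw [hγ0, linePt_self]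
      rw [← Path.Homotopic.Quotient.mk_symm, ← Path.Homotopic.Quotient.mk_trans, hconst,
        Path.Homotopic.Quotient.mk_refl]
      exact H.one_mem
    | succ k ih =>
      intro hk ω' hω'
      have hk' : k < N := hk
      obtain ⟨ω, hω⟩ := hpiece k hk'
      have h₀ : Good U s ω ((γ (pt N k hk'.le) : U) : E) := by
        have := hω 0; rwa [(piecePath γ hk').source] at this
      have h₁ : Good U s ω ((γ (pt N (k + 1) hk') : U) : E) := by
        have := hω 1; rwa [(piecePath γ hk').target] at this
      have hsq := mk_eq_radPath_symm_trans hs ω (piecePath γ hk') hω h₀ h₁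
      obtain ⟨q, hqG, hq₁, hq₂, hY⟩ := exists_mem_radPath_trans_symm_eq hU hs hG ω ω' h₁ hω'
      have hX := ih hk'.le ω h₀
      rw [mk_prefixPath_succ γ hk', hsq, Path.Homotopic.Quotient.trans_assoc,
        Path.Homotopic.Quotient.trans_assoc, ← Path.Homotopic.Quotient.trans_assoc
          (Path.Homotopic.Quotient.mk (prefixPath γ (pt N k hk'.le))), hY, fromPath_trans]
      exact H.mul_mem (hHmem q hqG ω ω' hq₁ hq₂) hX
  -- the last break point is the base point
  obtain ⟨ω₀, -⟩ := exists_good_of_joinedIn (hslice s hs)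
  have hγN : ((γ (pt N N le_rfl) : U) : E) = s := by
    have : pt N N le_rfl = 1 := Subtype.ext (by simp [hNR.ne'])
    rw [this, γ.target]
  have hωN : Good U s ω₀ ((γ (pt N N le_rfl) : U) : E) := by rw [hγN]; exact good_self hs ω₀
  have hlast := claim N le_rfl ω₀ hωN
  have heq : (prefixPath γ (pt N N le_rfl)).trans (radPath hs ω₀ _ hωN).symm =
      γ.trans (Path.refl _) := by
    ext u
    refine congrArg Subtype.val (PlanarLasso.trans_apply_congr _ _ _ _ (fun v => ?_) (fun v => ?_) u)
    · rw [prefixPath_apply, coe_pt, div_self hNR.ne', mul_one, Path.extend_extends']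
    · apply Subtype.ext
      change linePt s ((γ (pt N N le_rfl) : U) : E) _ = s
      rw [hγN, linePt_self]
  rw [← Path.Homotopic.Quotient.mk_symm, ← Path.Homotopic.Quotient.mk_trans, heq,
    Path.Homotopic.Quotient.mk_trans, Path.Homotopic.Quotient.mk_refl,
    Path.Homotopic.Quotient.trans_refl] at hlast
  exact hlast

end LineSlice

end Literature.AlgebraicTopology.FundamentalGroup
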